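import Summits.BirchSwinnertonDyer.BirchSwinnertonDyer.Theorems.PlecticLegsKatoDescentLevelRaise
import Literature.NumberTheory.EllipticCurves.KatoTwistedSelmerFinitenessProofs
import HarnessLib

/-!
# `KatoDescent` (route PlecticLegs, item stmt-BirchSwinnertonDyer-18262) modulo the CURRENT apex
# named facts: modularity and Kato 2004, Cor. 14.3 (1) (Selmer level)

The route item `KatoDescent` (rank equality `rank E(F) = rank E(ℚ)` for `F ⊂ ℚ(ζ_m)` the fixed
field of `H`, given `L(E, χ, 1) ≠ 0` for every non-trivial `χ` mod `m` trivial on `H`) is closed in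
the tree modulo two named facts (`plecticLegs_katoDescent_of_kato_fact`,
`PlecticLegsKatoDescentLevelRaise.lean`): modularity `exists_isNewformOf` (Breuil–Conrad–Diamond–
Taylor 2001, Thm. A) and Kato's Cor. 14.3 (2) `kato_finite_chiPart_of_twistedLValue_ne_zero`
(finiteness of `E(ℚ(ζ_m))^(χ)`).

Since then the Literature side vendored Kato's Cor. 14.3 **(1)** — finiteness of the `χ`-part of
`Sel_{p^∞}(E/ℚ(ζ_m))` at every prime `p`, `kato_finite_chiPart_selmer_of_twistedLValue_ne_zero`
(`KatoTwistedSelmerFiniteness.lean`) — and PROVED the printed passage (1) ⇒ (2) (`χ`-part Kummer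
descent, `kato_finite_chiPart_of_twistedLValue_ne_zero_of_kato_finite_chiPart_selmer`,
`KatoTwistedSelmerFinitenessProofs.lean`). This file records the composite: the item now rests on
modularity and the Selmer-level fact (1) alone, which is the statement Kato's Euler-system
argument (Thm. 14.2 (2), §§8–13, 14.6–14.13) actually proves. Nothing of that argument is here.

## References

* K. Kato, *`p`-adic Hodge theory and values of zeta functions of modular forms*, Astérisque 295
  (2004), 117–290: Thm. 14.2 (2), Cor. 14.3 (1)(2) (p. 235). [Kato2004Asterisque]
* C. Breuil, B. Conrad, F. Diamond, R. Taylor, *On the modularity of elliptic curves over `ℚ`: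
  wild 3-adic exercises*, J. Amer. Math. Soc. 14 (2001), Thm. A. [BCDT2001]
-/

-- the summit and its single sub-problem share the name `BirchSwinnertonDyer` (D-0017 nested layout)
set_option linter.dupNamespace false

noncomputable section

open Summit.BirchSwinnertonDyer.BirchSwinnertonDyer.Theses.PlecticLegs

namespace Summit.BirchSwinnertonDyer.BirchSwinnertonDyer.Theorems

/-- **The item `KatoDescent` modulo modularity and Kato's Cor. 14.3 (1).** If every elliptic curve
over `ℚ` has a newform (`exists_isNewformOf`, BCDT 2001 Thm. A) and, for every elliptic `E/ℚ` with
newform `f`, every `m ≢ 2 (mod 4)`, every Dirichlet character `χ` mod `m` with `L(f, χ, 1) ≠ 0`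
and every prime `p`, the `χ`-part of `Sel_{p^∞}(E/ℚ(ζ_m))` is finite
(`kato_finite_chiPart_selmer_of_twistedLValue_ne_zero`, Kato 2004 Cor. 14.3 (1) of Thm. 14.2 (2)),
then `KatoDescent` holds: Cor. 14.3 (1) ⇒ (2) by the proved `χ`-part Kummer descent
(`kato_finite_chiPart_of_twistedLValue_ne_zero_of_kato_finite_chiPart_selmer`), then
`plecticLegs_katoDescent_of_kato_fact` (level raising to all `m`, isotypic rank algebra, Galois
descent). [cite: Kato2004Asterisque, Cor. 14.3 (1)(2) (p. 235)] -/
theorem plecticLegs_katoDescent_of_kato_selmer_fact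
    (hmod : Literature.NumberTheory.EllipticCurves.ModularForms.exists_isNewformOf)
    (hSel : Literature.NumberTheory.EllipticCurves.kato_finite_chiPart_selmer_of_twistedLValue_ne_zero) :
    KatoDescent :=
  plecticLegs_katoDescent_of_kato_fact hmod
    (Literature.NumberTheory.EllipticCurves.kato_finite_chiPart_of_twistedLValue_ne_zero_of_kato_finite_chiPart_selmer
      hSel)

end Summit.BirchSwinnertonDyer.BirchSwinnertonDyer.Theorems

end
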